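import Literature.Combinatorics.LorentzianPolynomials.Quadratic
import Literature.Combinatorics.StablePolynomials.Basic
import HarnessLib

/-!
# Lorentzian quadratic forms are exactly the stable quadratic forms with nonnegative coefficients
# (Brändén–Huh 2020, §2.1 Lemma 2.5 and the sentence following it; Prop. 2.2 in degree `2`)

Layer `Literature/Combinatorics/LorentzianPolynomials`, namespace `Literature.Combinatorics.LorentzianPolynomials`;
lane `lit-hodgefound` (Track 2 foundations library), seat p16, generation 27 (row g27-#14). The bridge between the
lane's Lorentzian-polynomial files (`lorentzian σ 2`, `hessian`, `mem_lorentzian_two_iff_sigPos` of `Quadratic.lean`),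
the tree's stable-polynomial library (`Literature.Combinatorics.StablePolynomials.IsRealStable`, and its
`dotProduct_mulVec_sq_ge` = the reverse Cauchy–Schwarz inequality of a stable quadratic form) and the Lorentz-signature
linear algebra of `Literature.LinearAlgebra.QuadraticForm.LorentzianReverseSchwarz` (`mul_le_sq_of_sigPos_le_one`,
`sigPos_le_one_of_orthogonal_nonpos`, `not_self_pos_of_orthogonal_of_self_pos`).

## Source (verbatim) — P. Brändén, J. Huh, *Lorentzian polynomials* [BrandenHuh2019] (held `paper:arxiv-1902.03719`)

§2.1, Lemma 2.5: "The following conditions are equivalent for any `f ∈ P^2_n`. (1) The Hessian of `f` has the Lorentzian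
signature `(+,-,…,-)`, that is, `f ∈ L̊^2_n`. (2) For any nonzero `u ∈ ℝ^n_{≥0}`, `(u^T 𝓗_f v)^2 > (u^T 𝓗_f u)(v^T 𝓗_f v)`
for any `v ∈ ℝ^n` not parallel to `u`. (3) For some `u ∈ ℝ^n_{≥0}`, [the same]. (4) For any nonzero `u ∈ ℝ^n_{≥0}`, the
univariate polynomial `f(xu - v)` in `x` has two distinct real zeros for any `v ∈ ℝ^n` not parallel to `u`. (5) For some
`u ∈ ℝ^n_{≥0}`, [the same]. It follows that a quadratic form with nonnegative coefficients is strictly Lorentzian if and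
only if it is strictly stable. Thus, a quadratic form with nonnegative coefficients is Lorentzian if and only if it is
stable." Proof, (1) ⟹ (2): "the restriction of `𝓗_f` to the plane spanned by `u, v` has signature `(+,-)`. It follows
that […] `(u^T 𝓗_f u)(v^T 𝓗_f v) - (u^T 𝓗_f v)^2 < 0`." (3) ⟹ (1): "`𝓗_f` is negative definite on the hyperplane
`{v ∈ ℝ^n | u^T 𝓗_f v = 0}`. Since `f ∈ P^2_n`, we have `u^T 𝓗_f u > 0`, and hence `𝓗_f` has the Lorentzian signature."
"The remaining implications follow from the fact that the univariate polynomial `½ f(xu - v)` has the discriminant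
`(u^T 𝓗_f v)^2 - (u^T 𝓗_f u)(v^T 𝓗_f v)`." §2.1: "a polynomial `f` […] is stable if `f` is non-vanishing on `ℋ^n` or
identically zero, where `ℋ` is the open upper half plane in `ℂ`", and Prop. 2.2: "Any polynomial in `S^d_n` is
Lorentzian."

Here everything is the CLOSED (non-strict) version, for the tree's `lorentzian σ 2` (Brändén–Huh Def. 2.6): `≥` for `>`,
"at most one positive eigenvalue" for "Lorentzian signature", "has a real zero" for "two distinct real zeros", and
Brändén–Huh's "stable or identically zero" is written out as `q = 0 ∨ IsRealStable q` (the tree's `IsRealStable`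
excludes `0`, following Borcea–Brändén).

## What is here (`q` a real quadratic form in the variables `σ`, `𝓗 = hessian q`, `B = Matrix.toBilin' 𝓗 : (u, v) ↦ uᵀ𝓗v`)

* §1 Euler's formula for quadratics: `2q = Σ_{i,j} 𝓗_{ij} w_i w_j` (`two_nsmul_eq_sum_X_mul_X_mul_C_hessian`), hence
  `2 q(x) = xᵀ𝓗x` (`two_mul_eval_eq_toBilin'_hessian`), the complex evaluation `2 q(z) = Σ 𝓗_{ij} z_i z_j`, its real and
  imaginary parts at `z = x + iy` (`B x x - B y y` and `2 B x y`), `q(tu - v) = q(u) t² - (uᵀ𝓗v) t + q(v)` and its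
  discriminant `(uᵀ𝓗v)² - (uᵀ𝓗u)(vᵀ𝓗v)`; `q(y) > 0` for `q ≠ 0` with nonnegative coefficients and `y > 0`.
* §2 **stable ⟹ Lorentzian** (`mem_lorentzian_two_of_isRealStable`, Prop. 2.2 for `d = 2`, via the stable-polynomial
  library's reverse Cauchy–Schwarz `dotProduct_mulVec_sq_ge` at `u = 𝟙` and `sigPos_le_one_of_orthogonal_nonpos`).
* §3 **Lorentzian ⟹ stable** (`isRealStable_of_mem_lorentzian_two`: a zero `x + iy ∈ ℋ^n` would give `B x y = 0`,
  `B x x = B y y = 2 q(y) > 0`, two orthogonal positive vectors against `sigPos ≤ 1`), and the printed equivalence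
  **`mem_lorentzian_two_iff_isRealStable`**.
* §4 Lemma 2.5 (1) ⟺ (2) ⟺ (3) ⟺ (4) ⟺ (5), closed form: `mul_le_sq_of_mem_lorentzian_two` ((1) ⟹ (2)),
  `mem_lorentzian_two_of_mul_le_sq` ((3) ⟹ (1)), `mem_lorentzian_two_iff_forall_mul_le_sq`,
  `mem_lorentzian_two_iff_exists_mul_le_sq`, and the discriminant / real-zero forms
  `mem_lorentzian_two_iff_forall_discrim_nonneg`, `exists_eval_smul_sub_eq_zero_iff`.

Theorems only (no definition, no named fact; net debt 0).

## References

* [BrandenHuh2019] P. Brändén, J. Huh, *Lorentzian polynomials*, Ann. of Math. (2) 192 (2020) 821–891, arXiv:1902.03719 —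
  §2.1 Lemma 2.5 and the two sentences after it, Prop. 2.2, Def. 2.1/2.6.
* [BorceaBranden2009] J. Borcea, P. Brändén, *The Lee–Yang and Pólya–Schur programs. I*, Invent. Math. 177 (2009) — §1
  (stable / real stable), the convention of `Literature.Combinatorics.StablePolynomials.Basic`.
-/

noncomputable section

open MvPolynomial Finsupp Finset Matrix
open Literature.Combinatorics.StablePolynomials Literature.LinearAlgebra.QuadraticForm

namespace Literature.Combinatorics.LorentzianPolynomials

variable {σ : Type*} [Fintype σ]

/-! ## §1 Euler's formula for a quadratic form and its evaluations -/

section Euler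

/-- **Euler's formula for a quadratic form**: `2q = Σ_{i,j} w_i w_j 𝓗_{ji}` with `𝓗 = (∂_i∂_j q)` the Hessian ("the
quadratic polynomial `w^T A w`"; here from Mathlib's Euler identity `Σ_i w_i ∂_i f = d f` applied twice).
[cite: BrandenHuh2019, §2.1 (p. 8, "the symmetric matrix"); §3.2 Lemma 3.11 ("`w^T A w`")] -/
theorem two_nsmul_eq_sum_X_mul_X_mul_C_hessian {q : MvPolynomial σ ℝ} (hq : q.IsHomogeneous 2) :
    2 • q = ∑ i, ∑ j, X i * (X j * C (hessian q j i)) := by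
  rw [← hq.sum_X_mul_pderiv]
  refine Finset.sum_congr rfl fun i _ ↦ ?_
  have hpi : (pderiv i q).IsHomogeneous 1 := by simpa using hq.pderiv (i := i)
  have h2 := hpi.sum_X_mul_pderiv
  rw [one_nsmul] at h2
  rw [← h2, Finset.mul_sum]
  refine Finset.sum_congr rfl fun j _ ↦ ?_
  have h0 : (pderiv j (pderiv i q)).IsHomogeneous 0 := by simpa using hpi.pderiv (i := j)
  have hC : pderiv j (pderiv i q) = C (coeff 0 (pderiv j (pderiv i q))) :=
    totalDegree_eq_zero_iff_eq_C.1 (Nat.le_zero.1 h0.totalDegree_le)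
  rw [hC, hessian_apply]

/-- `2 q(x) = Σ_{i,j} 𝓗_{ij} x_i x_j` for real `x`. [cite: BrandenHuh2019, §2.1 Lemma 2.5 (proof, "`u^T 𝓗_f u`")] -/
theorem two_mul_eval_eq_sum_hessian {q : MvPolynomial σ ℝ} (hq : q.IsHomogeneous 2) (x : σ → ℝ) :
    2 * eval x q = ∑ i, ∑ j, hessian q i j * x i * x j := by
  have h := congrArg (eval x) (two_nsmul_eq_sum_X_mul_X_mul_C_hessian hq)
  rw [map_nsmul, nsmul_eq_mul, Nat.cast_ofNat, map_sum] at h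
  rw [h]
  refine Finset.sum_congr rfl fun i _ ↦ ?_
  rw [map_sum]
  refine Finset.sum_congr rfl fun j _ ↦ ?_
  rw [map_mul, map_mul, eval_X, eval_X, eval_C, hessian_comm q j i]
  ring

variable [DecidableEq σ]

/-- `uᵀ𝓗v = Σ_{i,j} 𝓗_{ij} u_i v_j` (Mathlib's `Matrix.toBilin'`). [cite: BrandenHuh2019, §2.1 Lemma 2.5 ("`u^T 𝓗_f v`")] -/
theorem toBilin'_hessian_apply (q : MvPolynomial σ ℝ) (u v : σ → ℝ) :
    Matrix.toBilin' (hessian q) u v = ∑ i, ∑ j, hessian q i j * u i * v j := by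
  rw [Matrix.toBilin'_apply]
  refine Finset.sum_congr rfl fun i _ ↦ Finset.sum_congr rfl fun j _ ↦ ?_
  ring

/-- `(u, v) ↦ uᵀ𝓗v` is symmetric. [cite: BrandenHuh2019, §2.1 (p. 8, "the symmetric matrix")] -/
theorem isSymm_toBilin'_hessian (q : MvPolynomial σ ℝ) : LinearMap.IsSymm (Matrix.toBilin' (hessian q)) :=
  ⟨fun v w ↦ by
    rw [Matrix.toBilin'_apply', Matrix.toBilin'_apply', Matrix.dotProduct_mulVec, ← Matrix.mulVec_transpose,
      (isSymm_hessian q).eq, dotProduct_comm, RingHom.id_apply]⟩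

/-- `vᵀ𝓗u = uᵀ𝓗v`. [cite: BrandenHuh2019, §2.1 (p. 8, "the symmetric matrix")] -/
theorem toBilin'_hessian_comm (q : MvPolynomial σ ℝ) (u v : σ → ℝ) :
    Matrix.toBilin' (hessian q) v u = Matrix.toBilin' (hessian q) u v := by
  exact ((isSymm_toBilin'_hessian q).eq u v).symm

/-- **`2 q(x) = xᵀ𝓗x`** (Euler's formula evaluated). [cite: BrandenHuh2019, §2.1 Lemma 2.5 (proof: "`½ f(xu - v)` has the
discriminant `(u^T 𝓗_f v)^2 - (u^T 𝓗_f u)(v^T 𝓗_f v)`")] -/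
theorem two_mul_eval_eq_toBilin'_hessian {q : MvPolynomial σ ℝ} (hq : q.IsHomogeneous 2) (x : σ → ℝ) :
    2 * eval x q = Matrix.toBilin' (hessian q) x x := by
  rw [toBilin'_hessian_apply, two_mul_eval_eq_sum_hessian hq]

/-- **`q(tu - v) = q(u) t² - (uᵀ𝓗v) t + q(v)`**: the univariate restriction of Lemma 2.5 (4)/(5) (in Mathlib's
`a * (x * x) + b * x + c` shape). [cite: BrandenHuh2019, §2.1 Lemma 2.5 ((4), (5) and the last paragraph of the proof)] -/
theorem eval_smul_sub_eq {q : MvPolynomial σ ℝ} (hq : q.IsHomogeneous 2) (t : ℝ) (u v : σ → ℝ) :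
    eval (t • u - v) q = eval u q * (t * t) + -Matrix.toBilin' (hessian q) u v * t + eval v q := by
  have h := two_mul_eval_eq_toBilin'_hessian hq (t • u - v)
  have hu := two_mul_eval_eq_toBilin'_hessian hq u
  have hv := two_mul_eval_eq_toBilin'_hessian hq v
  have hc := toBilin'_hessian_comm q u v
  simp only [map_sub, map_smul, LinearMap.sub_apply, LinearMap.smul_apply, smul_eq_mul] at h
  linear_combination (1 / 2 : ℝ) * h - (t * t / 2) * hu - (1 / 2 : ℝ) * hv - (t / 2) * hc

/-- The discriminant of `x ↦ q(xu - v)` is `(uᵀ𝓗v)² - (uᵀ𝓗u)(vᵀ𝓗v)` (Brändén–Huh's "`½ f(xu - v)` has the discriminant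
`(u^T 𝓗_f v)^2 - (u^T 𝓗_f u)(v^T 𝓗_f v)`", up to the normalisation `𝓗_{½f} = ½ 𝓗_f`).
[cite: BrandenHuh2019, §2.1 Lemma 2.5 (last paragraph of the proof)] -/
theorem discrim_eval_eq {q : MvPolynomial σ ℝ} (hq : q.IsHomogeneous 2) (u v : σ → ℝ) :
    discrim (eval u q) (-Matrix.toBilin' (hessian q) u v) (eval v q) =
      Matrix.toBilin' (hessian q) u v ^ 2 - Matrix.toBilin' (hessian q) u u * Matrix.toBilin' (hessian q) v v := by
  rw [discrim, ← two_mul_eval_eq_toBilin'_hessian hq u, ← two_mul_eval_eq_toBilin'_hessian hq v]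
  ring

omit [DecidableEq σ] in
/-- **`2 q(z) = Σ_{i,j} 𝓗_{ij} z_i z_j` for complex `z`** (the quadratic form extended to `ℂ^n`, as in the definition of
stability). [cite: BrandenHuh2019, §2.1 (p. 8, "`f` is non-vanishing on `ℋ^n`")] -/
theorem two_mul_eval₂_eq_sum_hessian {q : MvPolynomial σ ℝ} (hq : q.IsHomogeneous 2) (z : σ → ℂ) :
    2 * eval₂ (algebraMap ℝ ℂ) z q = ∑ i, ∑ j, (hessian q i j : ℂ) * z i * z j := by
  have h := congrArg (eval₂Hom (algebraMap ℝ ℂ) z) (two_nsmul_eq_sum_X_mul_X_mul_C_hessian hq)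
  simp only [map_nsmul, map_sum, map_mul] at h
  simp only [coe_eval₂Hom, eval₂_X, eval₂_C, Complex.coe_algebraMap, nsmul_eq_mul, Nat.cast_ofNat] at h
  rw [h]
  refine Finset.sum_congr rfl fun i _ ↦ Finset.sum_congr rfl fun j _ ↦ ?_
  rw [hessian_comm q j i]
  ring

omit [DecidableEq σ] in
/-- Real part of `Σ 𝓗_{ij} z_i z_j` at `z = x + iy`: `Σ 𝓗_{ij} x_i x_j - Σ 𝓗_{ij} y_i y_j`.
[cite: BrandenHuh2019, §2.1 (p. 8, "`f` is non-vanishing on `ℋ^n`")] -/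
theorem re_sum_hessian_mul (H : Matrix σ σ ℝ) (z : σ → ℂ) :
    (∑ i, ∑ j, (H i j : ℂ) * z i * z j).re =
      (∑ i, ∑ j, H i j * (z i).re * (z j).re) - ∑ i, ∑ j, H i j * (z i).im * (z j).im := by
  have key : ∀ i j, ((H i j : ℂ) * z i * z j).re = H i j * (z i).re * (z j).re - H i j * (z i).im * (z j).im :=
    fun i j ↦ by rw [Complex.mul_re, Complex.mul_re, Complex.mul_im, Complex.ofReal_re, Complex.ofReal_im]; ring
  rw [Complex.re_sum, ← Finset.sum_sub_distrib]
  refine Finset.sum_congr rfl fun i _ ↦ ?_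
  rw [Complex.re_sum, ← Finset.sum_sub_distrib]
  exact Finset.sum_congr rfl fun j _ ↦ key i j

omit [DecidableEq σ] in
/-- Imaginary part of `Σ 𝓗_{ij} z_i z_j` at `z = x + iy`: `Σ 𝓗_{ij} (x_i y_j + y_i x_j)`.
[cite: BrandenHuh2019, §2.1 (p. 8, "`f` is non-vanishing on `ℋ^n`")] -/
theorem im_sum_hessian_mul (H : Matrix σ σ ℝ) (z : σ → ℂ) :
    (∑ i, ∑ j, (H i j : ℂ) * z i * z j).im =
      (∑ i, ∑ j, H i j * (z i).re * (z j).im) + ∑ i, ∑ j, H i j * (z i).im * (z j).re := by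
  have key : ∀ i j, ((H i j : ℂ) * z i * z j).im = H i j * (z i).re * (z j).im + H i j * (z i).im * (z j).re :=
    fun i j ↦ by rw [Complex.mul_im, Complex.mul_re, Complex.mul_im, Complex.ofReal_re, Complex.ofReal_im]; ring
  rw [Complex.im_sum, ← Finset.sum_add_distrib]
  refine Finset.sum_congr rfl fun i _ ↦ ?_
  rw [Complex.im_sum, ← Finset.sum_add_distrib]
  exact Finset.sum_congr rfl fun j _ ↦ key i j

omit [Fintype σ] [DecidableEq σ] in
/-- A nonzero polynomial with nonnegative coefficients is positive on the open positive orthant ("Since `f ∈ P^2_n`, we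
have `u^T 𝓗_f u > 0`"; here for `f` with nonnegative coefficients and `u > 0`).
[cite: BrandenHuh2019, §2.1 Lemma 2.5 (proof of (3) ⟹ (1))] -/
theorem eval_pos_of_coeff_nonneg {q : MvPolynomial σ ℝ} (hnn : ∀ α, 0 ≤ coeff α q) (hq0 : q ≠ 0) {y : σ → ℝ}
    (hy : ∀ i, 0 < y i) : 0 < eval y q := by
  rw [eval_eq]
  refine Finset.sum_pos (fun α hα ↦ mul_pos (lt_of_le_of_ne (hnn α) (Ne.symm (MvPolynomial.mem_support_iff.1 hα)))
    (Finset.prod_pos fun i _ ↦ pow_pos (hy i) _)) ?_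
  rw [Finset.nonempty_iff_ne_empty, Ne, MvPolynomial.support_eq_empty]
  exact hq0

omit [Fintype σ] [DecidableEq σ] in
/-- A polynomial with nonnegative coefficients is nonnegative on the closed positive orthant.
[cite: BrandenHuh2019, §2.1 Lemma 2.5 ((2): "nonzero `u ∈ ℝ^n_{≥0}`")] -/
theorem eval_nonneg_of_coeff_nonneg {q : MvPolynomial σ ℝ} (hnn : ∀ α, 0 ≤ coeff α q) {y : σ → ℝ} (hy : ∀ i, 0 ≤ y i) :
    0 ≤ eval y q := by
  rw [eval_eq]
  exact Finset.sum_nonneg fun α _ ↦ mul_nonneg (hnn α) (Finset.prod_nonneg fun i _ ↦ pow_nonneg (hy i) _)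

/-- `uᵀ𝓗u = 2 q(u) ≥ 0` for `u ∈ ℝ^n_{≥0}` when `q` has nonnegative coefficients.
[cite: BrandenHuh2019, §2.1 Lemma 2.5 ((2): "nonzero `u ∈ ℝ^n_{≥0}`")] -/
theorem toBilin'_hessian_self_nonneg {q : MvPolynomial σ ℝ} (hq : q.IsHomogeneous 2) (hnn : ∀ α, 0 ≤ coeff α q)
    {u : σ → ℝ} (hu : ∀ i, 0 ≤ u i) : 0 ≤ Matrix.toBilin' (hessian q) u u := by
  rw [← two_mul_eval_eq_toBilin'_hessian hq]
  exact mul_nonneg zero_le_two (eval_nonneg_of_coeff_nonneg hnn hu)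

/-- `uᵀ𝓗u = 2 q(u) > 0` for `u ∈ ℝ^n_{>0}` when `q ≠ 0` has nonnegative coefficients ("Since `f ∈ P^2_n`, we have
`u^T 𝓗_f u > 0`"). [cite: BrandenHuh2019, §2.1 Lemma 2.5 (proof of (3) ⟹ (1))] -/
theorem toBilin'_hessian_self_pos {q : MvPolynomial σ ℝ} (hq : q.IsHomogeneous 2) (hnn : ∀ α, 0 ≤ coeff α q)
    (hq0 : q ≠ 0) {u : σ → ℝ} (hu : ∀ i, 0 < u i) : 0 < Matrix.toBilin' (hessian q) u u := by
  rw [← two_mul_eval_eq_toBilin'_hessian hq]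
  exact mul_pos zero_lt_two (eval_pos_of_coeff_nonneg hnn hq0 hu)

end Euler

variable [DecidableEq σ]

/-! ## §2 Stable ⟹ Lorentzian (Prop. 2.2 in degree two; Lemma 2.5 (3) ⟹ (1)) -/

section StableToLorentzian

omit [DecidableEq σ] in
/-- A stable real quadratic form does not vanish on `ℋ^n`, in the coordinates `Σ 𝓗_{ij} z_i z_j = 2 q(z)`.
[cite: BrandenHuh2019, §2.1 (p. 8, "`f` is non-vanishing on `ℋ^n`")] -/
theorem sum_hessian_mul_ne_zero_of_isRealStable {q : MvPolynomial σ ℝ} (hq : q.IsHomogeneous 2) (hst : IsRealStable q)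
    (z : σ → ℂ) (hz : ∀ i, 0 < (z i).im) : (∑ i, ∑ j, (hessian q i j : ℂ) * z i * z j) ≠ 0 := by
  rw [← two_mul_eval₂_eq_sum_hessian hq z]
  exact mul_ne_zero two_ne_zero ((isRealStable_iff q).1 hst z hz)

/-- **Lemma 2.5, (3) ⟹ (1) (closed form)**: if `uᵀ𝓗u > 0` and `(uᵀ𝓗v)² ≥ (uᵀ𝓗u)(vᵀ𝓗v)` for all `v`, then "`𝓗_f` is
negative [semi]definite on the hyperplane `{v ∈ ℝ^n | u^T 𝓗_f v = 0}` […] and hence `𝓗_f` has [at most one positive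
eigenvalue]". [cite: BrandenHuh2019, §2.1 Lemma 2.5 (proof of (3) ⟹ (1))] -/
theorem sigPos_hessian_le_one_of_mul_le_sq {q : MvPolynomial σ ℝ} {u : σ → ℝ} (hu : 0 < Matrix.toBilin' (hessian q) u u)
    (h : ∀ v, Matrix.toBilin' (hessian q) u u * Matrix.toBilin' (hessian q) v v ≤ Matrix.toBilin' (hessian q) u v ^ 2) :
    sigPos (Matrix.toBilin' (hessian q)).toQuadraticMap ≤ 1 := by
  refine sigPos_le_one_of_orthogonal_nonpos (Matrix.toBilin' (hessian q)) (w := u) fun v hv ↦ ?_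
  have h' := h v
  rw [← toBilin'_hessian_comm q u v, hv, sq, mul_zero] at h'
  nlinarith [h', hu]

/-- **A stable quadratic form with nonnegative coefficients has a Hessian with at most one positive eigenvalue**
(Lemma 2.5 (5) ⟹ (3) ⟹ (1) at `u = 𝟙`: stability gives the reverse Cauchy–Schwarz inequality
`(𝟙ᵀ𝓗v)² ≥ (𝟙ᵀ𝓗𝟙)(vᵀ𝓗v)` — the tree's `dotProduct_mulVec_sq_ge` — and `𝟙ᵀ𝓗𝟙 = 2 q(𝟙) > 0` unless `q = 0`).
[cite: BrandenHuh2019, §2.1 Lemma 2.5 (proof of (3) ⟹ (1)); Prop. 2.2] -/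
theorem sigPos_hessian_le_one_of_isRealStable {q : MvPolynomial σ ℝ} (hq : q.IsHomogeneous 2)
    (hnn : ∀ α, 0 ≤ coeff α q) (hst : IsRealStable q) : sigPos (Matrix.toBilin' (hessian q)).toQuadraticMap ≤ 1 := by
  by_cases hq0 : q = 0
  · refine sigPos_le_one_of_orthogonal_nonpos (Matrix.toBilin' (hessian q)) (w := 0) fun v _ ↦ ?_
    rw [← two_mul_eval_eq_toBilin'_hessian hq, hq0, map_zero, mul_zero]
  · have h1 : 0 < Matrix.toBilin' (hessian q) (fun _ ↦ 1) (fun _ ↦ 1) :=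
      toBilin'_hessian_self_pos hq hnn hq0 fun _ ↦ zero_lt_one
    refine sigPos_hessian_le_one_of_mul_le_sq h1 fun v ↦ ?_
    have h := dotProduct_mulVec_sq_ge (hessian q) (isSymm_hessian q) (sum_hessian_mul_ne_zero_of_isRealStable hq hst)
      (fun _ ↦ 1) v fun _ ↦ zero_le_one
    simpa only [Matrix.toBilin'_apply'] using h

/-- **Stable ⟹ Lorentzian for quadratic forms** ("Any polynomial in `S^d_n` is Lorentzian", `d = 2`; with the tree's
convention `S = {real stable} ∪ {0}`, nonnegative coefficients assumed as in `S^d_n`).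
[cite: BrandenHuh2019, §2.1 Prop. 2.2; Lemma 2.5 ("a quadratic form with nonnegative coefficients is Lorentzian if and
only if it is stable")] -/
theorem mem_lorentzian_two_of_isRealStable {q : MvPolynomial σ ℝ} (hq : q.IsHomogeneous 2) (hnn : ∀ α, 0 ≤ coeff α q)
    (hst : IsRealStable q) : q ∈ lorentzian σ 2 :=
  mem_lorentzian_two_iff_sigPos.2 ⟨hq, hnn, sigPos_hessian_le_one_of_isRealStable hq hnn hst⟩

end StableToLorentzian

/-! ## §3 Lorentzian ⟹ stable, and the equivalence -/

section LorentzianToStable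

/-- **A Lorentzian quadratic form is stable (or zero)**: a zero `z = x + iy ∈ ℋ^n` of `q` gives `xᵀ𝓗y = 0` and
`xᵀ𝓗x = yᵀ𝓗y = 2 q(y) > 0` — two `𝓗`-orthogonal vectors of positive square, impossible when `𝓗` has at most one
positive eigenvalue. [cite: BrandenHuh2019, §2.1 Lemma 2.5 ("a quadratic form with nonnegative coefficients is
Lorentzian if and only if it is stable"; proof of (1) ⟹ (2): "the restriction of `𝓗_f` to the plane spanned by `u, v`")]
-/
theorem isRealStable_of_mem_lorentzian_two {q : MvPolynomial σ ℝ} (hf : q ∈ lorentzian σ 2) (hq0 : q ≠ 0) :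
    IsRealStable q := by
  obtain ⟨hq, hnn, h1⟩ := mem_lorentzian_two_iff_sigPos.1 hf
  rw [isRealStable_iff]
  intro z hz h0
  set x : σ → ℝ := fun i ↦ (z i).re with hx
  set y : σ → ℝ := fun i ↦ (z i).im with hy
  have hsum : (∑ i, ∑ j, (hessian q i j : ℂ) * z i * z j) = 0 := by
    rw [← two_mul_eval₂_eq_sum_hessian hq z, h0, mul_zero]
  have hre := congrArg Complex.re hsum
  have him := congrArg Complex.im hsum
  rw [re_sum_hessian_mul, Complex.zero_re] at hre
  rw [im_sum_hessian_mul, Complex.zero_im] at him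
  -- in terms of `B = uᵀ𝓗v`
  have hxx : Matrix.toBilin' (hessian q) x x = ∑ i, ∑ j, hessian q i j * (z i).re * (z j).re :=
    toBilin'_hessian_apply q x x
  have hyy : Matrix.toBilin' (hessian q) y y = ∑ i, ∑ j, hessian q i j * (z i).im * (z j).im :=
    toBilin'_hessian_apply q y y
  have hxy : Matrix.toBilin' (hessian q) x y = ∑ i, ∑ j, hessian q i j * (z i).re * (z j).im :=
    toBilin'_hessian_apply q x y
  have hyx : Matrix.toBilin' (hessian q) y x = ∑ i, ∑ j, hessian q i j * (z i).im * (z j).re :=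
    toBilin'_hessian_apply q y x
  have hc := toBilin'_hessian_comm q x y
  have hypos : 0 < Matrix.toBilin' (hessian q) y y := toBilin'_hessian_self_pos hq hnn hq0 hz
  have horth : Matrix.toBilin' (hessian q) x y = 0 := by linarith
  have hxpos : 0 < Matrix.toBilin' (hessian q) x x := by linarith
  exact not_self_pos_of_orthogonal_of_self_pos (Matrix.toBilin' (hessian q)) (isSymm_toBilin'_hessian q) h1 hypos horth
    hxpos

/-- **"A quadratic form with nonnegative coefficients is Lorentzian if and only if it is stable"** (Brändén–Huh's
"stable" = non-vanishing on `ℋ^n` or identically zero). [cite: BrandenHuh2019, §2.1 Lemma 2.5 (the sentence after it);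
Prop. 2.2] -/
theorem mem_lorentzian_two_iff_isRealStable {q : MvPolynomial σ ℝ} (hq : q.IsHomogeneous 2) (hnn : ∀ α, 0 ≤ coeff α q) :
    q ∈ lorentzian σ 2 ↔ q = 0 ∨ IsRealStable q := by
  constructor
  · intro hf
    by_cases hq0 : q = 0
    · exact Or.inl hq0
    · exact Or.inr (isRealStable_of_mem_lorentzian_two hf hq0)
  · rintro (rfl | hst)
    · exact zero_mem_lorentzian 2
    · exact mem_lorentzian_two_of_isRealStable hq hnn hst

/-- The same for a polynomial already known to be Lorentzian: `q ∈ L^2_n` is zero or real stable.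
[cite: BrandenHuh2019, §2.1 Lemma 2.5 (the sentence after it)] -/
theorem eq_zero_or_isRealStable_of_mem_lorentzian_two {q : MvPolynomial σ ℝ} (hf : q ∈ lorentzian σ 2) :
    q = 0 ∨ IsRealStable q :=
  (mem_lorentzian_two_iff_isRealStable (isHomogeneous_of_mem_lorentzian hf) (coeff_nonneg_of_mem_lorentzian hf)).1 hf

end LorentzianToStable

/-! ## §4 Lemma 2.5 in closed form: reverse Cauchy–Schwarz and discriminants -/

section LemmaTwoFive

/-- **Lemma 2.5, (1) ⟹ (2) (closed form)**: for a Lorentzian quadratic form, `(uᵀ𝓗u)(vᵀ𝓗v) ≤ (uᵀ𝓗v)²` whenever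
`uᵀ𝓗u ≥ 0` (in particular for every `u ∈ ℝ^n_{≥0}`) — "the restriction of `𝓗_f` to the plane spanned by `u, v` has
[at most one positive eigenvalue, so its determinant is `≤ 0`]". [cite: BrandenHuh2019, §2.1 Lemma 2.5 ((1) ⟹ (2))] -/
theorem mul_le_sq_of_mem_lorentzian_two {q : MvPolynomial σ ℝ} (hf : q ∈ lorentzian σ 2) (u v : σ → ℝ)
    (hu : 0 ≤ Matrix.toBilin' (hessian q) u u) :
    Matrix.toBilin' (hessian q) u u * Matrix.toBilin' (hessian q) v v ≤ Matrix.toBilin' (hessian q) u v ^ 2 := by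
  have h := mul_le_sq_of_sigPos_le_one (Matrix.toBilin' (hessian q)) (isSymm_toBilin'_hessian q)
    (mem_lorentzian_two_iff_sigPos.1 hf).2.2 v u hu
  rwa [toBilin'_hessian_comm q u v, mul_comm] at h

/-- Lemma 2.5, (1) ⟹ (2) for `u ∈ ℝ^n_{≥0}`: `(uᵀ𝓗u)(vᵀ𝓗v) ≤ (uᵀ𝓗v)²`.
[cite: BrandenHuh2019, §2.1 Lemma 2.5 ((2): "For any nonzero `u ∈ ℝ^n_{≥0}`")] -/
theorem mul_le_sq_of_mem_lorentzian_two_of_nonneg {q : MvPolynomial σ ℝ} (hf : q ∈ lorentzian σ 2) {u : σ → ℝ}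
    (hu : ∀ i, 0 ≤ u i) (v : σ → ℝ) :
    Matrix.toBilin' (hessian q) u u * Matrix.toBilin' (hessian q) v v ≤ Matrix.toBilin' (hessian q) u v ^ 2 :=
  mul_le_sq_of_mem_lorentzian_two hf u v
    (toBilin'_hessian_self_nonneg (isHomogeneous_of_mem_lorentzian hf) (coeff_nonneg_of_mem_lorentzian hf) hu)

/-- In values of `q`: `4 q(u) q(v) ≤ (uᵀ𝓗v)²` for `q` Lorentzian and `u ∈ ℝ^n_{≥0}`.
[cite: BrandenHuh2019, §2.1 Lemma 2.5 ((1) ⟹ (2), (4))] -/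
theorem four_mul_eval_mul_eval_le_sq {q : MvPolynomial σ ℝ} (hf : q ∈ lorentzian σ 2) {u : σ → ℝ} (hu : ∀ i, 0 ≤ u i)
    (v : σ → ℝ) : 4 * eval u q * eval v q ≤ Matrix.toBilin' (hessian q) u v ^ 2 := by
  have h := mul_le_sq_of_mem_lorentzian_two_of_nonneg hf hu v
  rw [← two_mul_eval_eq_toBilin'_hessian (isHomogeneous_of_mem_lorentzian hf),
    ← two_mul_eval_eq_toBilin'_hessian (isHomogeneous_of_mem_lorentzian hf)] at h
  linarith

/-- **Lemma 2.5, (3) ⟹ (1) (closed form)** for a quadratic form with nonnegative coefficients: one `u` with `uᵀ𝓗u > 0`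
and `(uᵀ𝓗v)² ≥ (uᵀ𝓗u)(vᵀ𝓗v)` for all `v` makes `q` Lorentzian. [cite: BrandenHuh2019, §2.1 Lemma 2.5 ((3) ⟹ (1))] -/
theorem mem_lorentzian_two_of_mul_le_sq {q : MvPolynomial σ ℝ} (hq : q.IsHomogeneous 2) (hnn : ∀ α, 0 ≤ coeff α q)
    {u : σ → ℝ} (hu : 0 < Matrix.toBilin' (hessian q) u u)
    (h : ∀ v, Matrix.toBilin' (hessian q) u u * Matrix.toBilin' (hessian q) v v ≤ Matrix.toBilin' (hessian q) u v ^ 2) :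
    q ∈ lorentzian σ 2 :=
  mem_lorentzian_two_iff_sigPos.2 ⟨hq, hnn, sigPos_hessian_le_one_of_mul_le_sq hu h⟩

/-- **Lemma 2.5, (1) ⟺ (2) (closed form)**: a quadratic form with nonnegative coefficients is Lorentzian iff
`(uᵀ𝓗u)(vᵀ𝓗v) ≤ (uᵀ𝓗v)²` for every `u ∈ ℝ^n_{≥0}` and every `v`. [cite: BrandenHuh2019, §2.1 Lemma 2.5 ((1) ⟺ (2))] -/
theorem mem_lorentzian_two_iff_forall_mul_le_sq {q : MvPolynomial σ ℝ} (hq : q.IsHomogeneous 2)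
    (hnn : ∀ α, 0 ≤ coeff α q) :
    q ∈ lorentzian σ 2 ↔ ∀ u : σ → ℝ, (∀ i, 0 ≤ u i) → ∀ v,
      Matrix.toBilin' (hessian q) u u * Matrix.toBilin' (hessian q) v v ≤ Matrix.toBilin' (hessian q) u v ^ 2 := by
  refine ⟨fun hf u hu v ↦ mul_le_sq_of_mem_lorentzian_two_of_nonneg hf hu v, fun h ↦ ?_⟩
  by_cases hq0 : q = 0
  · rw [hq0]; exact zero_mem_lorentzian 2
  · exact mem_lorentzian_two_of_mul_le_sq hq hnn (toBilin'_hessian_self_pos hq hnn hq0 fun _ ↦ zero_lt_one)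
      (h _ fun _ ↦ zero_le_one)

/-- **Lemma 2.5, (1) ⟺ (3) (closed form)**: a nonzero quadratic form with nonnegative coefficients is Lorentzian iff for
SOME `u` with `uᵀ𝓗u > 0`, `(uᵀ𝓗u)(vᵀ𝓗v) ≤ (uᵀ𝓗v)²` for all `v`. [cite: BrandenHuh2019, §2.1 Lemma 2.5 ((1) ⟺ (3))] -/
theorem mem_lorentzian_two_iff_exists_mul_le_sq {q : MvPolynomial σ ℝ} (hq : q.IsHomogeneous 2)
    (hnn : ∀ α, 0 ≤ coeff α q) (hq0 : q ≠ 0) :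
    q ∈ lorentzian σ 2 ↔ ∃ u : σ → ℝ, 0 < Matrix.toBilin' (hessian q) u u ∧ ∀ v,
      Matrix.toBilin' (hessian q) u u * Matrix.toBilin' (hessian q) v v ≤ Matrix.toBilin' (hessian q) u v ^ 2 := by
  refine ⟨fun hf ↦ ⟨fun _ ↦ 1, toBilin'_hessian_self_pos hq hnn hq0 fun _ ↦ zero_lt_one, fun v ↦
    mul_le_sq_of_mem_lorentzian_two_of_nonneg hf (fun _ ↦ zero_le_one) v⟩, ?_⟩
  rintro ⟨u, hu, h⟩
  exact mem_lorentzian_two_of_mul_le_sq hq hnn hu h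

/-- **Lemma 2.5, (1) ⟺ (4) (closed form)**: a quadratic form with nonnegative coefficients is Lorentzian iff for every
`u ∈ ℝ^n_{≥0}` and every `v` the univariate `x ↦ q(xu - v)` has nonnegative discriminant ("has only real zeros").
[cite: BrandenHuh2019, §2.1 Lemma 2.5 ((1) ⟺ (4), last paragraph of the proof)] -/
theorem mem_lorentzian_two_iff_forall_discrim_nonneg {q : MvPolynomial σ ℝ} (hq : q.IsHomogeneous 2)
    (hnn : ∀ α, 0 ≤ coeff α q) :
    q ∈ lorentzian σ 2 ↔ ∀ u : σ → ℝ, (∀ i, 0 ≤ u i) → ∀ v,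
      0 ≤ discrim (eval u q) (-Matrix.toBilin' (hessian q) u v) (eval v q) := by
  rw [mem_lorentzian_two_iff_forall_mul_le_sq hq hnn]
  refine forall_congr' fun u ↦ imp_congr_right fun _ ↦ forall_congr' fun v ↦ ?_
  rw [discrim_eval_eq hq, sub_nonneg]

/-- **The real zeros of `x ↦ q(xu - v)`** (Lemma 2.5 (4)/(5)): for `q(u) ≠ 0`, `q(xu - v) = 0` has a real solution iff
the discriminant `(uᵀ𝓗v)² - (uᵀ𝓗u)(vᵀ𝓗v)` is nonnegative. [cite: BrandenHuh2019, §2.1 Lemma 2.5 ((4), (5), last paragraph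
of the proof)] -/
theorem exists_eval_smul_sub_eq_zero_iff {q : MvPolynomial σ ℝ} (hq : q.IsHomogeneous 2) {u : σ → ℝ} (hu : eval u q ≠ 0)
    (v : σ → ℝ) :
    (∃ t : ℝ, eval (t • u - v) q = 0) ↔
      0 ≤ Matrix.toBilin' (hessian q) u v ^ 2 - Matrix.toBilin' (hessian q) u u * Matrix.toBilin' (hessian q) v v := by
  rw [← discrim_eval_eq hq]
  simp_rw [eval_smul_sub_eq hq]
  constructor
  · rintro ⟨t, ht⟩
    rw [discrim_eq_sq_of_quadratic_eq_zero ht]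
    exact sq_nonneg _
  · intro h
    exact exists_quadratic_eq_zero hu ⟨Real.sqrt _, by rw [Real.mul_self_sqrt h]⟩

/-- **Lorentzian quadratic forms have real-rooted restrictions** (Lemma 2.5 (1) ⟹ (4), closed form): for `q ∈ L^2_n`,
`u ∈ ℝ^n_{≥0}` with `q(u) ≠ 0` and any `v`, `q(xu - v) = 0` for some real `x`.
[cite: BrandenHuh2019, §2.1 Lemma 2.5 ((1) ⟹ (4))] -/
theorem exists_eval_smul_sub_eq_zero_of_mem_lorentzian_two {q : MvPolynomial σ ℝ} (hf : q ∈ lorentzian σ 2) {u : σ → ℝ}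
    (hu : ∀ i, 0 ≤ u i) (hu0 : eval u q ≠ 0) (v : σ → ℝ) : ∃ t : ℝ, eval (t • u - v) q = 0 := by
  rw [exists_eval_smul_sub_eq_zero_iff (isHomogeneous_of_mem_lorentzian hf) hu0, sub_nonneg]
  exact mul_le_sq_of_mem_lorentzian_two_of_nonneg hf hu v

end LemmaTwoFive

end Literature.Combinatorics.LorentzianPolynomials

end
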